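import Summits.Parity.GeneralizedHardyLittlewood.Theorems.BeyondDiagonalBeatsQuarter.OffDiagCoreTruncationCount
import Summits.Parity.GeneralizedHardyLittlewood.Theorems.BeyondDiagonalBeatsQuarter.OffDiagCoreLedgerHeight
import HarnessLib

/-!
# Route `PrimeLevelFamEdge`, crux K_B (stmt-Parity-20343), line `diagonal_kernel_split` rev 4, plan Ω,
# key K1 = P8 **(T) of Ω-h v4 DISCHARGED**: `|offDiagNearHead Δ′ q − offDiagCore (coreHeight ε₀) Δ′ q| ≤ ε·ms`
# eventually, for L2's first height; hence **heart ⇐ (Ω) = a block bound for the FINITE dual core alone**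

Ω-h v4 (`OffDiagHeartCore.offDiagBelowSlack_io_of_coreBlockAtCleanScales`, p643105) reduced
`stub_offDiagBelowSlack_io` to (T) a dual-truncation estimate and (Ω) a block bound for the finite dual core
`offDiagCore Hf`. This file fixes the height function and proves (T):
* `coreHeight ε₀` (definition, reviewed): L2's first height
  `⌈(qc)·((1 + 4π√(αβ·2·2^{i₂})/(qc)·√(2·2^{i₁}))/(2^{i₁}/2))/(2π)·q^{ε₀}⌉` — the `hlen` shape of
  `OffDiagDualTruncationBox.tsum_tail_norm_fourier2_boxWeight_le` (prover-2) at `c ↦ q c`, `Q = q^{ε₀}`;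
* **`abs_offDiagNearHead_sub_offDiagCore_le_eventually`** — (T): for `0 < ε₀ ≤ 1`, every `Δ′ ∈ (1,2)` and
  `ε > 0` there is `q₀` with `|offDiagNearHead Δ′ q − offDiagCore (coreHeight ε₀) Δ′ q| ≤ ε·mainScaleReal Δ′ q`
  for all primes `q ≥ q₀`. Proof = the kit: `OffDiagCoreTruncationCount.abs_offDiagNearHead_sub_offDiagCore_le`
  (`|nearHead − core| ≤ (4πq̂/q)·TAIL₁`), `OffDiagCoreTruncationKit.exists_boxTail_fst_le` (L2 per box with
  `k = ⌈74/ε₀⌉ + 2` integrations by parts, every constant one monomial), `core_count_le` (`121q^{13}` boxes):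
  `(4πq̂/q)·TAIL₁ ≤ 484π𝓚_k·q^{74}·q^{−kε₀} ≤ 484π𝓚_k·q̂^{3/5} ≤ ε·ms` (`exists_qhat_rpow_le_mul_mainScaleReal`);
* `abs_offDiagCore_coreHeight_le` — K2 for this height (`OffDiagCoreLedgerHeight`): the trivial size
  `|offDiagCore (coreHeight ε₀) Δ′ q| ≤ q^{(5/4)(Δ′−1)+2ε₀+ε}·ms` eventually (`κ₀ = 5/4`);
* **`offDiagBelowSlack_io_of_coreBlock` / `_a₀`** — the heart (`stub_offDiagBelowSlack_io` verbatim) from (Ω)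
  ALONE: a block bound `Σ_{q∈goodPrimes} offDiagCore (coreHeight ε₀) Δ′ q ≤ U·Σ ms` at clean scales.
Helper; closes nothing ((Ω) is LIVE-Ω proper). Standard axioms.
«The programme SEARCHES and TYPES; no claim about Landau–Siegel zeros, Theorems 1–2 of arXiv:2211.02515 or
a repaired Margin232 until a kernel theorem says so.»
-/

noncomputable section

open Finset Polynomial
open scoped Real

namespace Summit.Parity.GeneralizedHardyLittlewood.Theorems.BeyondDiagonalBeatsQuarter.OffDiag

open Literature.NumberTheory.LFunctions Literature.NumberTheory.LFunctions.KMV2000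
open Literature.NumberTheory.Sieve.FriedlanderIwaniecPrimes (fourier2)
open PeterssonSplit (offDiag nearBoxes two_pi_mul_qhat_sq qhat_sq_le)

/-! ### §1. The height function -/

/-- **L2's first dual height** `H₁ = ⌈(qc)·D₁·q^{ε₀}/(2π)⌉`,
`D₁ = (1 + 4π√(αβ·2·2^{i₂})/(qc)·√(2·2^{i₁}))/(2^{i₁}/2)`: beyond it the `h₁`-tail of the dual series of the
box weight `Φ_i` (modulus `qc`) is `O(H₁·q^{−kε₀})` for every `k`
(`OffDiagDualTruncationBox.tsum_tail_norm_fourier2_boxWeight_le`). A bookkeeping choice of the line.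
[cite: KowalskiMichelVanderKam2000, Lemma 3.3 p. 9 — derivation] -/
def coreHeight (ε₀ : ℝ) : ℕ → ℕ → ℕ → ℕ → ℕ → ℕ → ℕ × ℕ → ℕ :=
  fun q _ _ α β c i ↦ ⌈((q * c : ℕ) : ℝ) * ((1 + 4 * π * Real.sqrt ((α : ℝ) * β * (2 * 2 ^ i.2)) /
    ((q : ℝ) * (c : ℝ)) * Real.sqrt (2 * 2 ^ i.1)) / ((2 : ℝ) ^ i.1 / 2)) / (2 * π) * (q : ℝ) ^ ε₀⌉₊

/-- Unfolding `coreHeight`. -/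
theorem coreHeight_apply (ε₀ : ℝ) (q d₁ d₂ α β c : ℕ) (i : ℕ × ℕ) :
    coreHeight ε₀ q d₁ d₂ α β c i = ⌈((q * c : ℕ) : ℝ) * ((1 + 4 * π * Real.sqrt ((α : ℝ) * β * (2 * 2 ^ i.2)) /
      ((q : ℝ) * (c : ℝ)) * Real.sqrt (2 * 2 ^ i.1)) / ((2 : ℝ) ^ i.1 / 2)) / (2 * π) * (q : ℝ) ^ ε₀⌉₊ := rfl

/-! ### §2. (T): the dual truncation costs `ε·ms` -/

/-- **(T) of Ω-h v4, discharged.** For `0 < ε₀ ≤ 1`: for every `Δ′ ∈ (1,2)` and `ε > 0` there is `q₀` such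
that `|offDiagNearHead Δ′ q − offDiagCore (coreHeight ε₀) Δ′ q| ≤ ε·mainScaleReal Δ′ q` for every prime `q ≥ q₀`.
[cite: KowalskiMichelVanderKam2000, (21)–(23) p. 12, Lemma 3.3 p. 9, §6 p. 19 — derivation] -/
theorem abs_offDiagNearHead_sub_offDiagCore_le_eventually {ε₀ : ℝ} (hε₀ : 0 < ε₀) (hε₁ : ε₀ ≤ 1) :
    ∀ Δ' : ℝ, 1 < Δ' → Δ' < 2 → ∀ ε : ℝ, 0 < ε → ∃ q₀ : ℕ, ∀ q : ℕ, q₀ ≤ q → q.Prime →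
      |offDiagNearHead Δ' q - offDiagCore (coreHeight ε₀) Δ' q| ≤ ε * mainScaleReal Δ' q := by
  intro Δ' h1 h2 ε hε
  -- the number of integrations by parts and the tail constant
  set k : ℕ := ⌈74 / ε₀⌉₊ + 2 with hk
  have hk2 : 2 ≤ k := by rw [hk]; omega
  have hkε : (74 : ℝ) ≤ ε₀ * k := by
    have h1' : (74 / ε₀ : ℝ) ≤ ⌈74 / ε₀⌉₊ := Nat.le_ceil _
    have h2' : (k : ℝ) = ⌈74 / ε₀⌉₊ + 2 := by rw [hk]; push_cast; ring
    rw [h2']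
    have h3 : ε₀ * (74 / ε₀) = 74 := by field_simp
    nlinarith
  obtain ⟨𝓚, h𝓚0, hbox⟩ := exists_boxTail_fst_le hk2 hε₀.le hε₁
  obtain ⟨q₂, hq₂⟩ := PeterssonSplit.exists_qhat_rpow_le_mul_mainScaleReal (K := 4 * π * (121 * 𝓚))
    (by positivity) hε
  refine ⟨max 40 q₂, fun q hq hprime ↦ ?_⟩
  haveI : NeZero q := ⟨hprime.ne_zero⟩
  have hq40 : 40 ≤ q := le_trans (le_max_left _ _) hq
  have hqq₂ : q₂ ≤ q := le_trans (le_max_right _ _) hq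
  have hq1n : 1 ≤ q := by omega
  have hq1 : (1 : ℝ) ≤ q := by exact_mod_cast hq1n
  have hq0 : (0 : ℝ) < q := by linarith
  have h0 : 0 < Δ' := lt_trans zero_lt_one h1
  -- `|nearHead − core| ≤ (4πq̂/q)·TAIL₁`
  have hsplit := abs_offDiagNearHead_sub_offDiagCore_le (q := q) (coreHeight ε₀) Δ'
  -- every weighted box tail is `≤ 𝓚 q^{61} (q^{ε₀})^{-k}`
  have hB0 : 0 ≤ 𝓚 * (q : ℝ) ^ 61 * (((q : ℝ) ^ ε₀) ^ k)⁻¹ := by positivity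
  have hfloorq : (⌊qhat q ^ Δ'⌋₊ : ℝ) ≤ q := by
    have hs1 : 1 < qhat q := one_lt_qhat hq40
    have hMq : qhat q ^ Δ' ≤ (q : ℝ) := by
      calc qhat q ^ Δ' ≤ qhat q ^ (2 : ℝ) := Real.rpow_le_rpow_of_exponent_le hs1.le h2.le
        _ = qhat q ^ 2 := by rw [show (2 : ℝ) = (2 : ℕ) by norm_num, Real.rpow_natCast]
        _ ≤ q := qhat_sq_le q
    exact (Nat.floor_le (by positivity)).trans hMq
  have h4s : 4 * qhat q ^ 2 * Real.log q ^ 4 ≤ (q : ℝ) ^ 5 := by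
    have h4 : 4 * qhat q ^ 2 ≤ (q : ℝ) := by
      rw [← two_pi_mul_qhat_sq q, show (2 * π * qhat q) ^ 2 = π ^ 2 * (4 * qhat q ^ 2) by ring]
      have hπ : (1 : ℝ) ≤ π ^ 2 := by nlinarith [Real.pi_gt_three]
      exact le_mul_of_one_le_left (by positivity) hπ
    have hL4 : Real.log q ^ 4 ≤ (q : ℝ) ^ 4 :=
      pow_le_pow_left₀ (Real.log_nonneg hq1) ((Real.log_le_sub_one_of_pos hq0).trans (by linarith)) 4
    calc 4 * qhat q ^ 2 * Real.log q ^ 4 ≤ (q : ℝ) * (q : ℝ) ^ 4 :=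
          mul_le_mul h4 hL4 (by positivity) (by positivity)
      _ = (q : ℝ) ^ 5 := by ring
  have hT := core_count_le hq40 h0 h2.le
    (fun r l m d₁ d₂ i ↦ ((q * (r + 1) : ℕ) : ℝ) * ∑' h : ℤ × ℤ,
      (if (coreHeight ε₀ q d₁ d₂ (l / d₁) (m / d₂) (r + 1) i : ℤ) < |h.1| then
        ‖fourier2 (boxWeight q d₁ d₂ (l / d₁) (m / d₂) (r + 1) i) (h.1 / (q * (r + 1) : ℕ))
          (h.2 / (q * (r + 1) : ℕ))‖ else 0))
    (fun r l m d₁ d₂ i ↦ mul_nonneg (Nat.cast_nonneg _) (tsum_nonneg fun h ↦ by split_ifs <;> positivity))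
    hB0 (fun r hr l hl m hm d₁ hd₁ d₂ hd₂ i hi ↦ by
      have hl1 : 1 ≤ l := (Finset.mem_Icc.mp hl).1
      have hm1 : 1 ≤ m := (Finset.mem_Icc.mp hm).1
      have hd₁1 := Nat.pos_of_mem_divisors hd₁
      have hd₂1 := Nat.pos_of_mem_divisors hd₂
      have hfar := PeterssonSplit.not_far_of_mem_nearBoxes hi
      rw [not_le] at hfar
      have hd' : (1 : ℝ) ≤ (d₁ : ℝ) * d₂ := by exact_mod_cast Nat.mul_pos hd₁1 hd₂1
      have hKK : (2 : ℝ) ^ i.1 * 2 ^ i.2 ≤ (q : ℝ) ^ 5 := by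
        calc (2 : ℝ) ^ i.1 * 2 ^ i.2 = 2 ^ (i.1 + i.2) := (pow_add _ _ _).symm
          _ ≤ 2 ^ (i.1 + i.2) * ((d₁ : ℝ) * d₂) := le_mul_of_one_le_right (by positivity) hd'
          _ ≤ 4 * qhat q ^ 2 * Real.log q ^ 4 := hfar.le
          _ ≤ (q : ℝ) ^ 5 := h4s
      have hK₁1 : (1 : ℝ) ≤ (2 : ℝ) ^ i.1 := one_le_pow₀ (by norm_num)
      have hK₂1 : (1 : ℝ) ≤ (2 : ℝ) ^ i.2 := one_le_pow₀ (by norm_num)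
      have hK₁ : (2 : ℝ) ^ i.1 ≤ (q : ℝ) ^ 5 := (le_mul_of_one_le_right (by positivity) hK₂1).trans hKK
      have hK₂ : (2 : ℝ) ^ i.2 ≤ (q : ℝ) ^ 5 := (le_mul_of_one_le_left (by positivity) hK₁1).trans hKK
      have hαq : (((l / d₁ : ℕ) : ℕ) : ℝ) ≤ q :=
        le_trans (by exact_mod_cast (Nat.div_le_self l d₁).trans (Finset.mem_Icc.mp hl).2) hfloorq
      have hβq : (((m / d₂ : ℕ) : ℕ) : ℝ) ≤ q :=
        le_trans (by exact_mod_cast (Nat.div_le_self m d₂).trans (Finset.mem_Icc.mp hm).2) hfloorq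
      exact hbox q d₁ d₂ (l / d₁) (m / d₂) r i hq1n hd₁1 hd₂1
        (OffDiagDual.one_le_div_of_dvd (Nat.dvd_of_mem_divisors hd₁) hl1)
        (OffDiagDual.one_le_div_of_dvd (Nat.dvd_of_mem_divisors hd₂) hm1) hαq hβq
        (Nat.succ_le_of_lt (Finset.mem_range.mp hr)) hK₁ hK₂)
  -- the count is `≤ 484π𝓚·q^{74}·q^{-kε₀} ≤ 484π𝓚 ≤ ε·ms`
  have hQk : (q : ℝ) ^ 74 ≤ ((q : ℝ) ^ ε₀) ^ k := by
    rw [← Real.rpow_natCast ((q : ℝ) ^ ε₀) k, ← Real.rpow_mul hq0.le, ← Real.rpow_natCast (q : ℝ) 74]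
    exact Real.rpow_le_rpow_of_exponent_le hq1 (by push_cast; linarith)
  have hTnum : 4 * π * (121 * (q : ℝ) ^ 13 * (𝓚 * (q : ℝ) ^ 61 * (((q : ℝ) ^ ε₀) ^ k)⁻¹)) ≤
      4 * π * (121 * 𝓚) := by
    have hQk0 : 0 < ((q : ℝ) ^ ε₀) ^ k := by positivity
    have hre : 121 * (q : ℝ) ^ 13 * (𝓚 * (q : ℝ) ^ 61 * (((q : ℝ) ^ ε₀) ^ k)⁻¹) =
        121 * 𝓚 * ((q : ℝ) ^ 74 / ((q : ℝ) ^ ε₀) ^ k) := by rw [div_eq_mul_inv]; ring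
    have hle1 : (q : ℝ) ^ 74 / ((q : ℝ) ^ ε₀) ^ k ≤ 1 := (div_le_one hQk0).mpr hQk
    rw [hre]
    calc 4 * π * (121 * 𝓚 * ((q : ℝ) ^ 74 / ((q : ℝ) ^ ε₀) ^ k)) ≤ 4 * π * (121 * 𝓚 * 1) := by gcongr
      _ = 4 * π * (121 * 𝓚) := by ring
  have hs1 : 1 ≤ qhat q := (one_lt_qhat hq40).le
  have hKms : 4 * π * (121 * 𝓚) ≤ ε * mainScaleReal Δ' q :=
    (le_mul_of_one_le_right (by positivity) (Real.one_le_rpow hs1 (by norm_num))).trans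
      (hq₂ q hqq₂ Δ' h0 h2.le)
  exact hsplit.trans (hT.trans (hTnum.trans hKms))

/-! ### §3. K2 at this height, and the heart from (Ω) alone -/

/-- **K2 at `coreHeight`**: for `0 < ε₀ ≤ 1`, `ε > 0` there is `q₀` with
`|offDiagCore (coreHeight ε₀) Δ′ q| ≤ q^{(5/4)(Δ′−1)+2ε₀+ε}·mainScaleReal Δ′ q` for all primes `q ≥ q₀` and
`Δ′ ∈ (1,2]` — the trivial size of the finite dual core (`OffDiagCoreLedgerHeight`).
[cite: KowalskiMichelVanderKam2000, (21)–(23) p. 12, Lemma 3.3 p. 9, §6 p. 19; HardyWright2008, Thm. 315 — derivation] -/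
theorem abs_offDiagCore_coreHeight_le {ε₀ ε : ℝ} (hε₀ : 0 < ε₀) (hε₁ : ε₀ ≤ 1) (hε : 0 < ε) :
    ∃ q₀ : ℕ, ∀ (q : ℕ) [NeZero q], q₀ ≤ q → q.Prime → ∀ Δ' : ℝ, 1 < Δ' → Δ' ≤ 2 →
      |offDiagCore (coreHeight ε₀) Δ' q| ≤ (q : ℝ) ^ (5 / 4 * (Δ' - 1) + 2 * ε₀ + ε) * mainScaleReal Δ' q :=
  abs_offDiagCore_ceilHeight_le hε₀ hε₁ hε

/-- **The heart from (Ω) alone (`c′₀`-first shell).** For any `0 < ε₀ ≤ 1`: a block bound for the finite dual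
core `offDiagCore (coreHeight ε₀)` at clean scales implies `stub_offDiagBelowSlack_io` VERBATIM
(Ω-h v4 + (T) of this file). [cite: MontgomeryVaughan2007, Cor. 11.10 (Page); KowalskiMichelVanderKam2000, §6 p. 19 — derivation] -/
theorem offDiagBelowSlack_io_of_coreBlock {ε₀ : ℝ} (hε₀ : 0 < ε₀) (hε₁ : ε₀ ≤ 1)
    (hΩ : ∀ c₀' : ℝ, 0 < c₀' → ∃ b : ℝ, 1 < b ∧ ∀ Δ' : ℝ, 1 < Δ' → Δ' < b →
      ∃ U : ℝ, U < 4 * (Δ' - 1) / Δ' ∧ ∃ a₀ : ℝ, 0 < a₀ ∧ ∃ η' : ℝ, 0 < η' ∧ η' < c₀' / a₀ ∧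
        ∃ N₀ : ℕ, ∀ N : ℕ, N₀ ≤ N → CleanScale a₀ η' N →
          ∑ q ∈ goodPrimes Δ' N, offDiagCore (coreHeight ε₀) Δ' q ≤
            U * ∑ q ∈ goodPrimes Δ' N, mainScaleReal Δ' q) :
    ∃ b : ℝ, 1 < b ∧ ∀ Δ' : ℝ, 1 < Δ' → Δ' < b → ∃ U : ℝ, U < 4 * (Δ' - 1) / Δ' ∧
      ∀ q₀ : ℕ, ∃ q : ℕ, ∃ _ : NeZero q, q₀ ≤ q ∧ q.Prime ∧
        (∀ n : ℕ, (n : ℝ) ≠ qhat q ^ Δ') ∧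
          -(∑ l ∈ Icc 1 ⌊qhat q ^ Δ'⌋₊, ∑ m ∈ Icc 1 ⌊qhat q ^ Δ'⌋₊,
              ((mollifierCoeff (X ^ 2) (qhat q ^ Δ') l * mollifierCoeff (X ^ 2) (qhat q ^ Δ') m : ℝ) : ℂ) *
                offDiag q l m).re ≤ U * mainScaleReal Δ' q :=
  offDiagBelowSlack_io_of_coreBlockAtCleanScales (coreHeight ε₀)
    (abs_offDiagNearHead_sub_offDiagCore_le_eventually hε₀ hε₁) hΩ

/-- **The heart from (Ω) alone (`a₀`-first shell).** [cite: MontgomeryVaughan2007, Cor. 11.10 (Page); KowalskiMichelVanderKam2000, §6 p. 19 — derivation] -/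
theorem offDiagBelowSlack_io_of_coreBlock_a₀ {ε₀ : ℝ} (hε₀ : 0 < ε₀) (hε₁ : ε₀ ≤ 1)
    (hΩ : ∃ a₀ : ℝ, 0 < a₀ ∧ ∀ η₀ : ℝ, 0 < η₀ → ∃ b : ℝ, 1 < b ∧ ∀ Δ' : ℝ, 1 < Δ' → Δ' < b →
      ∃ U : ℝ, U < 4 * (Δ' - 1) / Δ' ∧ ∃ η' : ℝ, 0 < η' ∧ η' < η₀ ∧ ∃ N₀ : ℕ, ∀ N : ℕ, N₀ ≤ N →
        CleanScale a₀ η' N →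
          ∑ q ∈ goodPrimes Δ' N, offDiagCore (coreHeight ε₀) Δ' q ≤
            U * ∑ q ∈ goodPrimes Δ' N, mainScaleReal Δ' q) :
    ∃ b : ℝ, 1 < b ∧ ∀ Δ' : ℝ, 1 < Δ' → Δ' < b → ∃ U : ℝ, U < 4 * (Δ' - 1) / Δ' ∧
      ∀ q₀ : ℕ, ∃ q : ℕ, ∃ _ : NeZero q, q₀ ≤ q ∧ q.Prime ∧
        (∀ n : ℕ, (n : ℝ) ≠ qhat q ^ Δ') ∧
          -(∑ l ∈ Icc 1 ⌊qhat q ^ Δ'⌋₊, ∑ m ∈ Icc 1 ⌊qhat q ^ Δ'⌋₊,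
              ((mollifierCoeff (X ^ 2) (qhat q ^ Δ') l * mollifierCoeff (X ^ 2) (qhat q ^ Δ') m : ℝ) : ℂ) *
                offDiag q l m).re ≤ U * mainScaleReal Δ' q :=
  offDiagBelowSlack_io_of_coreBlockAtCleanScales_a₀ (coreHeight ε₀)
    (abs_offDiagNearHead_sub_offDiagCore_le_eventually hε₀ hε₁) hΩ

end Summit.Parity.GeneralizedHardyLittlewood.Theorems.BeyondDiagonalBeatsQuarter.OffDiag
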